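import Summits.Ventures.DiscreteObjects.UnitDistance.KernelRupColouring
import HarnessLib

/-!
# The 3-colouring CNF is admissible by construction (`cnfOf_all_valid`)

Framing (verbatim for the cell): lottery ticket; floor = certified bounds/negative ranges.

Cell `pub-namedobj`, target (U), seat udg g14.  `KernelRupColouring.lean` generates the CNF `cnfOf nb n v₀ v₁` of 'the graph
`nb` on `n` vertices has a proper 3-colouring with `v₀ ↦ 0`, `v₁ ↦ 1`' and proves soundness through the syntactic recogniser
`validClause`, leaving the hypothesis `(cnfOf nb n v₀ v₁).all (validClause nb n v₀ v₁) = true` to be checked per instance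
(`decide +kernel`; for the 909-vertex witness over `ℚ(√59)` this check alone exceeded the gate's 600 s).  Here that hypothesis is
proved ONCE for every `nb, n, v₀, v₁` (`cnfOf_all_valid`): each generated clause is a vertex clause of a vertex `< n`, an edge
clause of an actual edge `v < w < n` (bit `w` of `nb v`), or one of the two units — exactly the shapes the recogniser accepts.
Corollary `not_proper_of_rup'`: the one-piece refutation lemma without the validity hypothesis.
-/

namespace Summit.Ventures.DiscreteObjects.UnitDistance.KRup

/-- Every vertex clause is admissible. -/
theorem validClause_vertex (nb : ℕ → ℕ) (n v₀ v₁ : ℕ) {v : ℕ} (hv : v < n) :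
    validClause nb n v₀ v₁ [pos v 0, pos v 1, pos v 2] = true := by
  have h6 : pos v 0 / 6 = v := by unfold pos; omega
  simp [validClause, h6, hv]

/-- Every edge clause of an actual edge is admissible. -/
theorem validClause_edge (nb : ℕ → ℕ) (n v₀ v₁ : ℕ) {v w c : ℕ} (hv : v < n) (hw : w < n)
    (hbit : Nat.testBit (nb v) w = true) (hc : c < 3) :
    validClause nb n v₀ v₁ [negl v c, negl w c] = true := by
  have h1 : negl v c % 2 = 1 := by unfold negl; omega
  have h2 : negl w c % 2 = 1 := by unfold negl; omega
  have h3 : negl v c / 2 = 3 * v + c := by unfold negl; omega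
  have h4 : negl w c / 2 = 3 * w + c := by unfold negl; omega
  have h5 : (3 * v + c) % 3 = c := by omega
  have h6 : (3 * w + c) % 3 = c := by omega
  have h7 : (3 * v + c) / 3 = v := by omega
  have h8 : (3 * w + c) / 3 = w := by omega
  simp [validClause, h1, h2, h3, h4, h5, h6, h7, h8, hv, hw, hbit]

/-- THE CNF IS ADMISSIBLE BY CONSTRUCTION: every clause of `cnfOf nb n v₀ v₁` passes the recogniser `validClause nb n v₀ v₁`
(no hypothesis on `nb, n, v₀, v₁`). -/
theorem cnfOf_all_valid (nb : ℕ → ℕ) (n v₀ v₁ : ℕ) : (cnfOf nb n v₀ v₁).all (validClause nb n v₀ v₁) = true := by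
  rw [List.all_eq_true]
  intro C hC
  simp only [cnfOf, List.mem_append, List.mem_map, List.mem_range, List.mem_flatMap, List.mem_cons,
    List.not_mem_nil, or_false] at hC
  rcases hC with (⟨v, hv, rfl⟩ | ⟨v, hv, hC⟩) | rfl | rfl
  · exact validClause_vertex nb n v₀ v₁ hv
  · simp only [edgeClauses, List.mem_flatMap, List.mem_filter, List.mem_range, Bool.and_eq_true,
      decide_eq_true_eq, List.mem_cons, List.not_mem_nil, or_false] at hC
    obtain ⟨w, ⟨hw, _, hbit⟩, hC⟩ := hC
    rcases hC with rfl | rfl | rfl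
    · exact validClause_edge nb n v₀ v₁ hv hw hbit (by omega)
    · exact validClause_edge nb n v₀ v₁ hv hw hbit (by omega)
    · exact validClause_edge nb n v₀ v₁ hv hw hbit (by omega)
  · simp [validClause]
  · simp [validClause]

/-- One-piece refutation WITHOUT the validity hypothesis: a kernel-checked RUP run on `cnfOf nb n v₀ v₁` that derives the
empty clause excludes every proper 3-colouring with `v₀ ↦ 0`, `v₁ ↦ 1`. -/
theorem not_proper_of_rup' {nb : ℕ → ℕ} {n v₀ v₁ : ℕ} {f d : ℕ} {steps : List (List ℕ × List ℕ)}
    (hrun : checkAll f d (Store.ofList d (cnfOf nb n v₀ v₁)) ((cnfOf nb n v₀ v₁).length + 1) steps = true)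
    (hnil : [] ∈ steps.map Prod.fst) {col : ℕ → ℕ} (hP : Proper3 nb n col) (h0 : col v₀ = 0) (h1 : col v₁ = 1) :
    False :=
  not_proper_of_rup (cnfOf_all_valid nb n v₀ v₁) hrun hnil hP h0 h1

end Summit.Ventures.DiscreteObjects.UnitDistance.KRup
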